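import Summits.QuantumFields.BalabanUV.T4Continuum.Support.VariationalTaxiTower

/-!
# T⁴ programme, spine node NE2 (U1a), lane P2 — SUPPLIER ITEM (O2′) «THE NE3 ADAPTER RE-TARGETED INTO THE RAW-DISTANCE SOCKET», file 1 of 2:
# the NESTED TAXI TRANSPORT OF A LEVEL-`k` CONNECTION through its iterated straight coarsenings, and CONTOUR TELESCOPING —
# `‖nest(R̄)(x) − nest(R)(x)‖ ≤ d·(L^k − 1)·sup_bonds ‖R̄ − R‖`

NE2 formalisation swarm `b2b-balaban-t4-ne2-formalise-*`, leaf prover 09 (gen 5); register row «P2-sup» of `t4/formal/NE2/LEAVES.md`; the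
road owner `b2b-balaban-t4-ne2-p2` (gen 11) re-targeted this lineage's (O2) adapter (journal CLAIMS.log l.11188 (2), l.11313 (iii); skeleton
`t4/skeletons/NE2-t4-ne2-p2.md` v0.12 §0 R ∕ §7): the TWO-RUNS END `VariationalCovariantTwoRunsEnd.towerLimitRate_twoRuns_closed` (p215328) ties
run `k` and run `k+1` at level `k` by RAW distances `‖Rb k − Rc k‖ ≤ ρ_k` (bond phases, common gauge) and `‖Tb k − T k‖ ≤ τ_k` (site
transports) with `n·ρ_k ≤ c_ρ·θ^k`, `τ_k ≤ c_τ·θ^k` — node NE3's currency.  The bond half comes from node U1b's `LocalRate` (file 2, via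
leaf-09-g4's `VariationalCovariantTwoRunsNE3.lev_mul_norm_coarsen_sub_le_of_localRate_max`); the SITE half «follows from the bond distance by
telescoping along contours» (owner, l.11188) once both runs' site transports are THE SAME CONTOUR SYSTEM applied to their own phases.  THIS FILE
types that contour system and proves the telescoping estimate:
 * §1 `pres n R` — a level-`n·L` connection in one-step-fine coordinates over level `n` (`Rtr (pres R) = R`, `pres (Rtr R′) = R′`; for a tower
   `Rc`, `pres (L^k) (Rc (k+1))` IS leaf-09-g4's `fineOf L M Rc k` by `rfl`);
 * §2 **`nestOf k R`** — THE NESTED TAXI TRANSPORT OF A LEVEL-`k` CONNECTION `R : Tor (fine (L^k) M) → Fin d → ℂ`: `nestOf 0 R = taxiT (L^0) M R`,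
   `nestOf (k+1) R = compT (L^k) L M (nestOf k (coarseT L _ (pres (L^k) R))) (taxiT L _ (pres (L^k) R))` (leaf-04-g2's taxis `taxiT`, straight
   coarsening `coarseT`, leaf-02-g3's `compT` BY NAME) — so that along a tower `Rc` the END's COMP⁺ binder
   `nestOf (k+1) (Rc (k+1)) = compT (nestOf k (coarseT (fineOf Rc k))) (taxiT (fineOf Rc k))` holds by `rfl` (`nestOf_succ_tower`); unit modulus
   (`norm_nestOf`); and the BRIDGE to leaf-04-g3's nested taxi tower over a COHERENT tower of one-step phases (`VariationalTaxiTower.nestT`):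
   `nestT R′ 0 = nestOf 0 (coarseT (R′ 0))`, **`nestT R′ (k+1) = nestOf (k+1) (Rtr (R′ k))`** (`nestT_succ_eq_nestOf`) — each run of the two-runs
   tower is a coherent tower, so (O7)∕(O10)'s discharges (`hwin∕hin∕hcross∕hmis∕hrel_taxiTower`) transfer to `nestOf` by this identity;
 * §3 TELESCOPING for unit phases `R̄, R` with `‖R̄(b) − R(b)‖ ≤ ρ` on every bond: `‖Π_t(R̄) − Π_t(R)‖ ≤ t·ρ` (`norm_piT_sub_piT_le`),
   `‖coarseT R̄ − coarseT R‖ ≤ L·ρ`, `‖leg_i(R̄) − leg_i(R)‖ ≤ (L−1)·ρ`, `‖taxiT R̄ x − taxiT R x‖ ≤ d·(L−1)·ρ`, and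
   **`norm_nestOf_sub_nestOf_le`**: `‖nestOf k R̄ x − nestOf k R x‖ ≤ d·(L^k − 1)·ρ` (induction over the nesting: `d(L−1) + L·d(L^k − 1) =
   d(L^{k+1} − 1)` fine bonds on the nested contour — fewer than `d·n`).
File 2 (`VariationalCovariantTwoRunsSocket`) plugs node U1b's `LocalRate` into the socket with `T k := nestOf k (Rc k)`, `Tb k := nestOf k (Rb k)`.
WHAT IS NOT HERE (stated, not hidden): any discharge of `LocalRate` (node NE3 ∕ U1b OPEN); the pair's transport-defect binders at taxi data
((O7) `VariationalTaxiTower(End)`, (O10) `VariationalTaxiNested(Tower)` — importable through §2's bridge, not re-proved); frames; the END (owner).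

HONEST FRAMING (T4-DAG p. 1).  Model level (U(1) bond phases and abelian taxi ∕ straight contours as DATA; [Balaban1985BackgroundPropagators]
(3.15) ∕ (3.19) p.393 SHAPES only — the non-abelian ordered products are untouched; no B0: the identification with Bałaban's `U_k(V)`, `Γ^{(j)}`
is the b05∕b09∕an2 dictionary); elementary bookkeeping, [folklore]; nothing printed is a hypothesis; no `def … : Prop`; no `sorry`; axioms
standard.  NE3 OPEN; NE2 NOT proved; spine PROVED 0∕9 unchanged; rung (B)+1 finite T⁴ — NOT infinite volume, NOT a mass gap, NOT Clay.  HONEST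
DEPENDENCY (cell, verbatim): continuum YM on T⁴ ⇐ BetaPertH ∧ nine spine estimates (0/9 proved); BetaPertH ⇐ (D1) ∧ (D4) ∧ CAP+tail; G-an2-4
gates asym, D1 and NE2/3/4.
-/

noncomputable section

open scoped BigOperators ComplexConjugate
open Finset

namespace Summit.QuantumFields.BalabanUV.T4Continuum.VariationalCovariantTwoRunsTransport

open Literature.MathematicalPhysics.QuantumFieldTheory.Balaban1983to89.B5Prop11Plancherel (Tor fine unitVec)
open Literature.MathematicalPhysics.QuantumFieldTheory.Balaban1983to89.B5Block118 (bpt tstep)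
open Literature.MathematicalPhysics.QuantumFieldTheory.Balaban1983to89.B5Blocks16 (blockOf)
open Literature.MathematicalPhysics.QuantumFieldTheory.Balaban1983to89.B5Composition116 (sites)
open Summit.QuantumFields.BalabanUV.T4Continuum.ScalarBlockTrialFunction (digits)
open Summit.QuantumFields.BalabanUV.T4Continuum.VariationalCovariantFederbush (piT)
open Summit.QuantumFields.BalabanUV.T4Continuum.VariationalCovariantTower (compT Rtr norm_compT)
open Summit.QuantumFields.BalabanUV.T4Continuum.VariationalTaxiTransport (leg taxi taxiT norm_piT norm_leg norm_taxiT)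
open Summit.QuantumFields.BalabanUV.T4Continuum.VariationalTaxiCoarse (coarseT norm_coarseT)
open Summit.QuantumFields.BalabanUV.T4Continuum.VariationalTaxiTower (nestT nestT_zero nestT_succ)

variable {d : ℕ} (L : ℕ) [NeZero L] (M : Fin d → ℕ) [hM : ∀ μ, NeZero (M μ)]

/-! ## §1 A level-`n·L` connection in one-step-fine coordinates -/

section Pres

variable (n : ℕ) [NeZero n]

/-- a level-`n·L` connection PRESENTED in one-step-fine coordinates over level `n` (inverse of leaf-02-g3's `Rtr`; for a tower `Rc`,
`pres (L^k) (Rc (k+1))` is leaf-09-g4's `fineOf L M Rc k` by `rfl`). [folklore] -/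
def pres (R : Tor (fine (n * L) M) → Fin d → ℂ) : Tor (fine L (fine n M)) → Fin d → ℂ := fun x' μ => R ((sites n L M).symm x') μ

omit [NeZero L] [NeZero n] hM in
/-- `pres` unfolds. [folklore] -/
theorem pres_apply (R : Tor (fine (n * L) M) → Fin d → ℂ) (x' : Tor (fine L (fine n M))) (μ : Fin d) :
    pres L M n R x' μ = R ((sites n L M).symm x') μ := rfl

omit [NeZero L] [NeZero n] hM in
/-- transporting the presentation back returns the connection: `Rtr (pres R) = R`. [folklore] -/
theorem Rtr_pres (R : Tor (fine (n * L) M) → Fin d → ℂ) : Rtr n L M (pres L M n R) = R := by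
  funext x μ
  simp [Rtr, pres]

omit [NeZero L] [NeZero n] hM in
/-- presenting transported one-step phases returns them: `pres (Rtr R′) = R′`. [folklore] -/
theorem pres_Rtr (R' : Tor (fine L (fine n M)) → Fin d → ℂ) : pres L M n (Rtr n L M R') = R' := by
  funext x' μ
  simp [Rtr, pres]

omit [NeZero L] [NeZero n] hM in
/-- unit phases stay unit in the presentation. [folklore] -/
theorem norm_pres {R : Tor (fine (n * L) M) → Fin d → ℂ} (hR1 : ∀ x μ, ‖R x μ‖ = 1) (x' : Tor (fine L (fine n M))) (μ : Fin d) :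
    ‖pres L M n R x' μ‖ = 1 := hR1 _ _

omit [NeZero L] [NeZero n] hM in
/-- bondwise distances are preserved by the presentation. [folklore] -/
theorem norm_pres_sub_pres_le {Rb R : Tor (fine (n * L) M) → Fin d → ℂ} {ρ : ℝ} (hρ : ∀ x μ, ‖Rb x μ - R x μ‖ ≤ ρ)
    (x' : Tor (fine L (fine n M))) (μ : Fin d) : ‖pres L M n Rb x' μ - pres L M n R x' μ‖ ≤ ρ := hρ _ _

end Pres

/-! ## §2 The nested taxi transport of a level-`k` connection -/

section Nest

/-- **THE NESTED TAXI TRANSPORT OF A LEVEL-`k` CONNECTION** through its iterated straight coarsenings: at level `0` the (trivial) straight taxi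
of the `1`-blocks; at level `k+1` the composite of the level-`k` nested transport of the straight `L`-bond coarsening with the one-step taxi inside
the `L`-block ([Balaban1985BackgroundPropagators] (3.15) ∕ (3.19) p.393 «R(U(Γ^{(j)}_{y,x}))», SHAPE only; abelian; phases as data). [folklore] -/
def nestOf : (k : ℕ) → (Tor (fine (L ^ k) M) → Fin d → ℂ) → Tor (fine (L ^ k) M) → ℂ
  | 0, R => taxiT (L ^ 0) M R
  | k + 1, R => compT (L ^ k) L M (nestOf k (coarseT L (fine (L ^ k) M) (pres L M (L ^ k) R))) (taxiT L (fine (L ^ k) M) (pres L M (L ^ k) R))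

/-- level `0`. [folklore] -/
theorem nestOf_zero (R : Tor (fine (L ^ 0) M) → Fin d → ℂ) : nestOf L M 0 R = taxiT (L ^ 0) M R := rfl

/-- the nesting step. [folklore] -/
theorem nestOf_succ (k : ℕ) (R : Tor (fine (L ^ (k + 1)) M) → Fin d → ℂ) :
    nestOf L M (k + 1) R
      = compT (L ^ k) L M (nestOf L M k (coarseT L (fine (L ^ k) M) (pres L M (L ^ k) R))) (taxiT L (fine (L ^ k) M) (pres L M (L ^ k) R)) :=
  rfl

/-- **COMP⁺ BY `rfl` ALONG A TOWER OF RUNS**: for `Rc : (k : ℕ) → Tor (fine (L^k) M) → Fin d → ℂ` (run `k`'s phases at its own level) the level-`k+1`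
nested transport is the composite of the nested transport of the ONCE-COARSENED run `k+1` with run `k+1`'s one-step taxi — literally the END's
binder `hTcomp` with `Tb k := nestOf k (coarseT (fineOf Rc k))`, `T′ k := taxiT (fineOf Rc k)` (`fineOf Rc k = pres (L^k) (Rc (k+1))` by `rfl`).
[folklore] -/
theorem nestOf_succ_tower (Rc : (k : ℕ) → Tor (fine (L ^ k) M) → Fin d → ℂ) (k : ℕ) :
    nestOf L M (k + 1) (Rc (k + 1))
      = compT (L ^ k) L M (nestOf L M k (coarseT L (fine (L ^ k) M) (fun x' μ => Rc (k + 1) ((sites (L ^ k) L M).symm x') μ)))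
          (taxiT L (fine (L ^ k) M) (fun x' μ => Rc (k + 1) ((sites (L ^ k) L M).symm x') μ)) :=
  rfl

/-- `|nestOf k R| = 1` for unit phases: the END's binders `hT` ∕ `hTb`. [folklore] -/
theorem norm_nestOf : ∀ (k : ℕ) {R : Tor (fine (L ^ k) M) → Fin d → ℂ}, (∀ x μ, ‖R x μ‖ = 1) → ∀ x, ‖nestOf L M k R x‖ = 1
  | 0, _, hR1, x => norm_taxiT (L ^ 0) M hR1 x
  | k + 1, _, hR1, x => by
    rw [nestOf_succ]
    exact norm_compT (L ^ k) L M
      (norm_nestOf k (norm_coarseT L (fine (L ^ k) M) (norm_pres L M (L ^ k) hR1)))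
      (norm_taxiT L (fine (L ^ k) M) (norm_pres L M (L ^ k) hR1)) x

/-- BRIDGE, level `0`: leaf-04-g3's nested taxi tower over a tower of one-step phases starts at `nestOf 0` of the level-`0` coarsening.
[folklore] -/
theorem nestT_zero_eq_nestOf (R' : (k : ℕ) → Tor (fine L (fine (L ^ k) M)) → Fin d → ℂ) :
    nestT L M R' 0 = nestOf L M 0 (coarseT L (fine (L ^ 0) M) (R' 0)) := rfl

/-- **BRIDGE TO THE COHERENT TAXI TOWER**: for a COHERENT tower of one-step phases (`coarseT (R′ (j+1)) = Rtr (R′ j)` below `k`) leaf-04-g3's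
`nestT R′ (k+1)` IS the nested taxi transport of the level-`k+1` connection `Rtr (R′ k)` — so every binder (O7)∕(O10) discharge for `nestT`
(`hrel_taxiTower`, `hwin∕hin∕hcross∕hmis_taxiTower`) is a statement about `nestOf`. [folklore] -/
theorem nestT_succ_eq_nestOf (R' : (k : ℕ) → Tor (fine L (fine (L ^ k) M)) → Fin d → ℂ) :
    ∀ k, (∀ j < k, coarseT L (fine (L ^ (j + 1)) M) (R' (j + 1)) = Rtr (L ^ j) L M (R' j)) →
      nestT L M R' (k + 1) = nestOf L M (k + 1) (Rtr (L ^ k) L M (R' k))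
  | 0, _ => by rw [nestT_succ, nestOf_succ, pres_Rtr, nestT_zero, nestOf_zero]
  | k + 1, hcoh => by
    rw [nestT_succ, nestOf_succ, pres_Rtr, hcoh k (Nat.lt_succ_self k),
      nestT_succ_eq_nestOf R' k fun j hj => hcoh j (Nat.lt_succ_of_lt hj)]

/-- the bridge under GLOBAL coherence (leaf-04-g3's hypothesis `hcoh`). [folklore] -/
theorem nestT_succ_eq_nestOf' {R' : (k : ℕ) → Tor (fine L (fine (L ^ k) M)) → Fin d → ℂ}
    (hcoh : ∀ j, coarseT L (fine (L ^ (j + 1)) M) (R' (j + 1)) = Rtr (L ^ j) L M (R' j)) (k : ℕ) :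
    nestT L M R' (k + 1) = nestOf L M (k + 1) (Rtr (L ^ k) L M (R' k)) :=
  nestT_succ_eq_nestOf L M R' k fun j _ => hcoh j

end Nest

/-! ## §3 Contour telescoping -/

section Telescope

omit [NeZero L] hM in
/-- products of contractions telescope: `‖a·b − a′·b′‖ ≤ ‖a − a′‖ + ‖b − b′‖` for `‖b‖ ≤ 1`, `‖a′‖ ≤ 1`. [folklore] -/
theorem norm_mul_sub_mul_le {a b a' b' : ℂ} (hb : ‖b‖ ≤ 1) (ha' : ‖a'‖ ≤ 1) : ‖a * b - a' * b'‖ ≤ ‖a - a'‖ + ‖b - b'‖ := by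
  have e : a * b - a' * b' = (a - a') * b + a' * (b - b') := by ring
  rw [e]
  refine (norm_add_le _ _).trans ?_
  rw [norm_mul, norm_mul]
  nlinarith [norm_nonneg (a - a'), norm_nonneg (b - b'), norm_nonneg b, norm_nonneg a']

omit [NeZero L] hM in
/-- products of unit factors telescope: `‖Π_s z̄ − Π_s z‖ ≤ Σ_s ‖z̄ − z‖`. [folklore] -/
theorem norm_prod_sub_prod_le {ι : Type*} [DecidableEq ι] (s : Finset ι) (zb z : ι → ℂ) (hzb : ∀ i ∈ s, ‖zb i‖ = 1)
    (hz : ∀ i ∈ s, ‖z i‖ = 1) : ‖∏ i ∈ s, zb i - ∏ i ∈ s, z i‖ ≤ ∑ i ∈ s, ‖zb i - z i‖ := by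
  induction s using Finset.induction_on with
  | empty => simp
  | insert i s hi ih =>
    rw [Finset.prod_insert hi, Finset.prod_insert hi, Finset.sum_insert hi]
    have h1 : ‖∏ k ∈ s, zb k‖ ≤ 1 :=
      (VariationalTaxiTransport.norm_prod_eq_one s zb fun k hk => hzb k (Finset.mem_insert_of_mem hk)).le
    have h2 : ‖z i‖ ≤ 1 := (hz i (Finset.mem_insert_self i s)).le
    have ih' := ih (fun k hk => hzb k (Finset.mem_insert_of_mem hk)) fun k hk => hz k (Finset.mem_insert_of_mem hk)
    exact (norm_mul_sub_mul_le h1 h2).trans (add_le_add le_rfl ih')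

variable (Lb : ℕ) [NeZero Lb] (N : Fin d → ℕ) [hN : ∀ μ, NeZero (N μ)]
variable {Rb R : Tor (fine Lb N) → Fin d → ℂ} (hRb1 : ∀ x μ, ‖Rb x μ‖ = 1) (hR1 : ∀ x μ, ‖R x μ‖ = 1)
variable {ρ : ℝ} (hρ : ∀ x μ, ‖Rb x μ - R x μ‖ ≤ ρ)
include hRb1 hR1 hρ

omit [NeZero Lb] hN in
/-- STRAIGHT LEGS TELESCOPE: `‖Π_t(R̄)(x,μ) − Π_t(R)(x,μ)‖ ≤ t·ρ`. [folklore] -/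
theorem norm_piT_sub_piT_le (x : Tor (fine Lb N)) (μ : Fin d) :
    ∀ t : ℕ, ‖piT Lb N Rb x μ t - piT Lb N R x μ t‖ ≤ t * ρ
  | 0 => by simp [piT]
  | t + 1 => by
    simp only [piT]
    calc ‖piT Lb N Rb x μ t * Rb (x + tstep (fine Lb N) μ t) μ - piT Lb N R x μ t * R (x + tstep (fine Lb N) μ t) μ‖
        ≤ ‖piT Lb N Rb x μ t - piT Lb N R x μ t‖ + ‖Rb (x + tstep (fine Lb N) μ t) μ - R (x + tstep (fine Lb N) μ t) μ‖ :=
          norm_mul_sub_mul_le (hRb1 _ _).le (norm_piT Lb N hR1 x μ t).le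
      _ ≤ t * ρ + ρ := add_le_add (norm_piT_sub_piT_le x μ t) (hρ _ _)
      _ = ((t + 1 : ℕ) : ℝ) * ρ := by push_cast; ring

omit hN in
/-- THE STRAIGHT COARSENING TELESCOPES: `‖coarseT R̄ (y,μ) − coarseT R (y,μ)‖ ≤ L·ρ`. [folklore] -/
theorem norm_coarseT_sub_coarseT_le (y : Tor N) (μ : Fin d) : ‖coarseT Lb N Rb y μ - coarseT Lb N R y μ‖ ≤ Lb * ρ :=
  norm_piT_sub_piT_le Lb N hRb1 hR1 hρ _ μ Lb

omit hN in
/-- ONE TAXI LEG TELESCOPES: `‖leg_i(R̄) − leg_i(R)‖ ≤ (L − 1)·ρ` (a leg has at most `L − 1` bonds). [folklore] -/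
theorem norm_leg_sub_leg_le (hρ0 : 0 ≤ ρ) (y : Tor N) (j : Fin d → Fin Lb) (i : ℕ) :
    ‖leg Lb N Rb y j i - leg Lb N R y j i‖ ≤ ((Lb : ℝ) - 1) * ρ := by
  have hL1 : (1 : ℝ) ≤ Lb := Nat.one_le_cast.mpr (Nat.one_le_iff_ne_zero.mpr (NeZero.ne Lb))
  unfold leg
  split_ifs with h
  · have hj : ((j ⟨i, h⟩ : ℕ) : ℝ) ≤ (Lb : ℝ) - 1 := by
      have := (j ⟨i, h⟩).is_lt
      have : ((j ⟨i, h⟩ : ℕ) : ℝ) + 1 ≤ Lb := by exact_mod_cast this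
      linarith
    exact (norm_piT_sub_piT_le Lb N hRb1 hR1 hρ _ _ _).trans (mul_le_mul_of_nonneg_right hj hρ0)
  · rw [sub_self, norm_zero]
    exact mul_nonneg (by linarith) hρ0

omit hN in
/-- THE TAXI TELESCOPES: `‖taxi(R̄)(y,j) − taxi(R)(y,j)‖ ≤ d·(L − 1)·ρ`. [folklore] -/
theorem norm_taxi_sub_taxi_le (hρ0 : 0 ≤ ρ) (y : Tor N) (j : Fin d → Fin Lb) :
    ‖taxi Lb N Rb y j - taxi Lb N R y j‖ ≤ (d : ℝ) * ((Lb : ℝ) - 1) * ρ := by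
  unfold taxi
  refine (norm_prod_sub_prod_le (Finset.range d) _ _ (fun i _ => norm_leg Lb N hRb1 y j i) fun i _ => norm_leg Lb N hR1 y j i).trans ?_
  calc ∑ i ∈ Finset.range d, ‖leg Lb N Rb y j i - leg Lb N R y j i‖
      ≤ ∑ _i ∈ Finset.range d, ((Lb : ℝ) - 1) * ρ := Finset.sum_le_sum fun i _ => norm_leg_sub_leg_le Lb N hRb1 hR1 hρ hρ0 y j i
    _ = (d : ℝ) * ((Lb : ℝ) - 1) * ρ := by rw [Finset.sum_const, Finset.card_range, nsmul_eq_mul]; ring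

/-- THE TAXI TRANSPORT TELESCOPES at every fine site: `‖taxiT R̄ x − taxiT R x‖ ≤ d·(L − 1)·ρ`. [folklore] -/
theorem norm_taxiT_sub_taxiT_le (hρ0 : 0 ≤ ρ) (x : Tor (fine Lb N)) :
    ‖taxiT Lb N Rb x - taxiT Lb N R x‖ ≤ (d : ℝ) * ((Lb : ℝ) - 1) * ρ := by
  unfold taxiT
  exact norm_taxi_sub_taxi_le Lb N hRb1 hR1 hρ hρ0 _ _

end Telescope

/-! ## §4 The nested contour telescopes: `d·(L^k − 1)` bonds -/

section NestTelescope

/-- **THE NESTED TAXI TRANSPORT TELESCOPES**: for unit level-`k` phases `R̄, R` with `‖R̄(b) − R(b)‖ ≤ ρ` on every bond,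
`‖nestOf k R̄ x − nestOf k R x‖ ≤ d·(L^k − 1)·ρ` at every site — the nested contour from the unit-block base point to `x` has
`d(L−1)·(1 + L + ⋯ + L^{k−1}) = d(L^k − 1)` fine bonds (induction over the nesting: the coarsened phases are `L·ρ`-close by
`norm_coarseT_sub_coarseT_le`, the one-step taxis `d(L−1)·ρ`-close by `norm_taxiT_sub_taxiT_le`). [folklore] -/
theorem norm_nestOf_sub_nestOf_le :
    ∀ (k : ℕ) {Rb R : Tor (fine (L ^ k) M) → Fin d → ℂ} {ρ : ℝ}, (∀ x μ, ‖Rb x μ‖ = 1) → (∀ x μ, ‖R x μ‖ = 1) → 0 ≤ ρ →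
      (∀ x μ, ‖Rb x μ - R x μ‖ ≤ ρ) → ∀ x, ‖nestOf L M k Rb x - nestOf L M k R x‖ ≤ (d : ℝ) * ((L : ℝ) ^ k - 1) * ρ
  | 0, Rb, R, ρ, hRb1, hR1, hρ0, hρ, x => by
    rw [nestOf_zero, nestOf_zero]
    have h := norm_taxiT_sub_taxiT_le (L ^ 0) M hRb1 hR1 hρ hρ0 x
    simpa using h
  | k + 1, Rb, R, ρ, hRb1, hR1, hρ0, hρ, x => by
    rw [nestOf_succ, nestOf_succ]
    unfold compT
    have hpb := norm_pres L M (L ^ k) hRb1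
    have hp := norm_pres L M (L ^ k) hR1
    have hpρ : ∀ x' μ, ‖pres L M (L ^ k) Rb x' μ - pres L M (L ^ k) R x' μ‖ ≤ ρ := norm_pres_sub_pres_le L M (L ^ k) hρ
    -- the coarsened phases: unit, `L·ρ`-close
    have hcb := norm_coarseT L (fine (L ^ k) M) hpb
    have hc := norm_coarseT L (fine (L ^ k) M) hp
    have hcρ : ∀ y μ, ‖coarseT L (fine (L ^ k) M) (pres L M (L ^ k) Rb) y μ - coarseT L (fine (L ^ k) M) (pres L M (L ^ k) R) y μ‖
        ≤ (L : ℝ) * ρ := norm_coarseT_sub_coarseT_le L (fine (L ^ k) M) hpb hp hpρ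
    have hLρ : 0 ≤ (L : ℝ) * ρ := mul_nonneg (Nat.cast_nonneg L) hρ0
    have ih := norm_nestOf_sub_nestOf_le k hcb hc hLρ hcρ
    have h1 := ih (blockOf L (fine (L ^ k) M) (sites (L ^ k) L M x))
    have h2 := norm_taxiT_sub_taxiT_le L (fine (L ^ k) M) hpb hp hpρ hρ0 (sites (L ^ k) L M x)
    have hA : ‖nestOf L M k (coarseT L (fine (L ^ k) M) (pres L M (L ^ k) R)) (blockOf L (fine (L ^ k) M) (sites (L ^ k) L M x))‖ ≤ 1 :=
      (norm_nestOf L M k hc _).le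
    have ht : ‖taxiT L (fine (L ^ k) M) (pres L M (L ^ k) Rb) (sites (L ^ k) L M x)‖ ≤ 1 := (norm_taxiT L (fine (L ^ k) M) hpb _).le
    refine (norm_mul_sub_mul_le ht hA).trans ?_
    refine (add_le_add h1 h2).trans (le_of_eq ?_)
    ring

/-- the same with the shorter constant `d·L^k·ρ` (`d·n` bonds). [folklore] -/
theorem norm_nestOf_sub_nestOf_le' (k : ℕ) {Rb R : Tor (fine (L ^ k) M) → Fin d → ℂ} {ρ : ℝ} (hRb1 : ∀ x μ, ‖Rb x μ‖ = 1)
    (hR1 : ∀ x μ, ‖R x μ‖ = 1) (hρ0 : 0 ≤ ρ) (hρ : ∀ x μ, ‖Rb x μ - R x μ‖ ≤ ρ) (x : Tor (fine (L ^ k) M)) :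
    ‖nestOf L M k Rb x - nestOf L M k R x‖ ≤ (d : ℝ) * (L : ℝ) ^ k * ρ := by
  refine (norm_nestOf_sub_nestOf_le L M k hRb1 hR1 hρ0 hρ x).trans ?_
  have : (0 : ℝ) ≤ (d : ℝ) * ρ := mul_nonneg (Nat.cast_nonneg d) hρ0
  nlinarith

end NestTelescope


end Summit.QuantumFields.BalabanUV.T4Continuum.VariationalCovariantTwoRunsTransport

end
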